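import Mathlib
import Literature.Probability.Process.PointStationaryLaw
import Literature.MathematicalPhysics.StatisticalMechanics.RootEnergy
import Literature.Geometry.DiscreteGeometry.MultiregularPointSystems
import Literature.Geometry.DiscreteGeometry.CrystallographicGroups
import Summits.AtomisticToContinuum.Crystallization.Theses.IsometryAtoms
import Summits.AtomisticToContinuum.Crystallization.Theorems.MinimisingLawsCohesive.Negative.OnePointMixtures
import Summits.AtomisticToContinuum.Crystallization.Theorems.PalmUnimodularRigidityCruxesToPalmRigidity
import Summits.AtomisticToContinuum.Crystallization.Theorems.PalmUnimodularRigidityMinimiserShellsEnergyFloor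
import Summits.AtomisticToContinuum.Crystallization.Theorems.MinimiserShells.Negative.Rootedness
import Summits.AtomisticToContinuum.Crystallization.Theorems.IsometryAtomsMinimisingLawsCohesivePureExhaustionAux1

/-!
# Stub `stub_pureExhaustion` of line `purity_stacking` — crux `IsometryAtoms.MinimisingLawsCohesive`
# (stmt-AtomisticToContinuum-15777)

Helper file for the registered stub `stub_pureExhaustion` (signature registered by `ledger skeleton check`
on the crux item; proved EXACTLY as stated). Lands at
`Summits/AtomisticToContinuum/Crystallization/Theorems/IsometryAtomsMinimisingLawsCohesivePureExhaustion.lean`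
with `--supports stmt-AtomisticToContinuum-15777`.

**Statement (PURE EXHAUSTION).** Given PURITY `X₁ = MinimisingLawsHaveAtoms` (every minimising
point-stationary a.s.-hard-core probability law charges the rooted isometry class
`Cls Y = {count|A(Y − q) : A, q ∈ Y}` of SOME `Y`), the ENERGY FLOOR (`e* ≤ E_P[rootEnergy]` for every
point-stationary a.s.-hard-core probability law) and MEASURABILITY of the `q`-slices of the classes of
separated sets: a minimising point-stationary a.s.-`δ`-hard-core probability law `P` is almost surely
carried by its CHARGED classes — a.e. `μ` lies in a class `Cls Y` with `P(Cls Y) > 0`.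

**Proof (conditioning on the invariant complement of the charged classes).** Classes of
`δ`-separated sets are measurable (`PureExhaustion.measurableSet_cls`) and equal-or-disjoint
(`PureExhaustion.cls_eq_of_mem_of_mem`), so the family `𝒦` of charged ones is countable
(`Measure.countable_meas_pos_of_disjoint_iUnion`) and its union `U` is measurable.  `U` is invariant
under re-rooting a.e. configuration at each of its points (`PureExhaustion.map_sub_mem_cls`; the way
back re-roots `θ_y μ` at its point `−y`).  If `P(Uᶜ) = 0` we are done.  Otherwise the conditioned law
`P(Uᶜ)⁻¹ • P|Uᶜ` is a probability law, a.s. hard-core, point-stationary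
(`PureExhaustion.pureExhaustion_isPointStationaryLaw_restrict_of_ae`) and minimising (the floor makes
the minimising face closed under almost-invariant conditioning,
`PureExhaustion.integral_rootEnergy_cond_le_of_ae`), so `X₁` gives a class `Cls Y` charged by it,
hence charged by `P` off `U`; such a class is the class of a `δ`-separated set
(`PureExhaustion.separated_of_measure_ne_zero`), so it belongs to `𝒦` and lies inside `U` —
contradiction.
-/

noncomputable section

open MeasureTheory
open scoped ENNReal

namespace Summit.AtomisticToContinuum.Crystallization.Theorems.IsometryAtomsMinimisingLawsCohesive

open PureExhaustion
open Literature.Probability.Process Literature.MathematicalPhysics.StatisticalMechanics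
open Summit.AtomisticToContinuum.Crystallization.Theorems.ChargedEnergyGapNegative (eStar)
open Summit.AtomisticToContinuum.Crystallization.Theorems.MinimiserShells.Negative.Rootedness
  (countable_of_separated)

/-- **Stub `stub_pureExhaustion`** of line `purity_stacking` (crux `IsometryAtoms.MinimisingLawsCohesive`,
stmt-AtomisticToContinuum-15777): PURE EXHAUSTION.  Given purity `X₁ = MinimisingLawsHaveAtoms`, the
energy floor `e* ≤ E_P[rootEnergy]` on point-stationary a.s.-hard-core probability laws, and
measurability of the `q`-slices `{count|A(Y − q) : A}` of the rooted isometry classes of separated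
sets, every minimising point-stationary a.s.-`δ`-hard-core probability law `P` is a.s. carried by its
CHARGED rooted isometry classes: for `P`-a.e. `μ` there is `Y` with `P(Cls Y) > 0` and `μ ∈ Cls Y`.
Proof: the charged classes of `δ`-separated sets form a countable family of measurable, pairwise
disjoint events whose union `U` is re-rooting invariant at the points of a.e. configuration; if
`P(Uᶜ) > 0`, the conditioned law `P(· | Uᶜ)` is again in the frame and minimising (floor ⇒ the
minimising face is closed under almost-invariant conditioning), so `X₁` gives it a charged class,
which is then charged by `P`, hence inside `U`: contradiction. [folklore] -/
theorem stub_pureExhaustion :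
    Summit.AtomisticToContinuum.Crystallization.Theses.IsometryAtoms.MinimisingLawsHaveAtoms →
    (∀ δ : ℝ, 0 < δ →
      ∀ P : MeasureTheory.Measure (MeasureTheory.Measure (EuclideanSpace ℝ (Fin 3))),
        MeasureTheory.IsProbabilityMeasure P →
        (∀ᵐ μ ∂P, Literature.Probability.Process.IsRootedHardCore δ μ) →
        Literature.Probability.Process.IsPointStationaryLaw P →
        (⨅ Q : Literature.MathematicalPhysics.StatisticalMechanics.PeriodicConfiguration 3,
            Q.energyPerParticle Literature.MathematicalPhysics.StatisticalMechanics.lennardJones) ≤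
          ∫ μ, Literature.MathematicalPhysics.StatisticalMechanics.rootEnergy
            Literature.MathematicalPhysics.StatisticalMechanics.lennardJones μ ∂P) →
    (∀ δ : ℝ, 0 < δ → ∀ Y : Set (EuclideanSpace ℝ (Fin 3)),
      (∀ x ∈ Y, ∀ y ∈ Y, x ≠ y → δ ≤ dist x y) → ∀ q : EuclideanSpace ℝ (Fin 3),
      MeasurableSet {μ : MeasureTheory.Measure (EuclideanSpace ℝ (Fin 3)) |
        ∃ A : EuclideanSpace ℝ (Fin 3) →ₗᵢ[ℝ] EuclideanSpace ℝ (Fin 3),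
          μ = (MeasureTheory.Measure.count : MeasureTheory.Measure (EuclideanSpace ℝ (Fin 3))).restrict
            ((fun s => A (s - q)) '' Y)}) →
    ∀ δ : ℝ, 0 < δ →
      ∀ P : MeasureTheory.Measure (MeasureTheory.Measure (EuclideanSpace ℝ (Fin 3))),
        MeasureTheory.IsProbabilityMeasure P →
        (∀ᵐ μ ∂P, Literature.Probability.Process.IsRootedHardCore δ μ) →
        Literature.Probability.Process.IsPointStationaryLaw P →
        (∫ μ, Literature.MathematicalPhysics.StatisticalMechanics.rootEnergy
            Literature.MathematicalPhysics.StatisticalMechanics.lennardJones μ ∂P) ≤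
          (⨅ Q : Literature.MathematicalPhysics.StatisticalMechanics.PeriodicConfiguration 3,
            Q.energyPerParticle Literature.MathematicalPhysics.StatisticalMechanics.lennardJones) →
        ∀ᵐ μ ∂P, ∃ Y : Set (EuclideanSpace ℝ (Fin 3)),
          0 < P {ν : MeasureTheory.Measure (EuclideanSpace ℝ (Fin 3)) |
                ∃ A : EuclideanSpace ℝ (Fin 3) →ₗᵢ[ℝ] EuclideanSpace ℝ (Fin 3), ∃ q ∈ Y,
                  ν = (MeasureTheory.Measure.count : MeasureTheory.Measure (EuclideanSpace ℝ (Fin 3))).restrict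
                    ((fun s => A (s - q)) '' Y)} ∧
          ∃ A : EuclideanSpace ℝ (Fin 3) →ₗᵢ[ℝ] EuclideanSpace ℝ (Fin 3), ∃ q ∈ Y,
            μ = (MeasureTheory.Measure.count : MeasureTheory.Measure (EuclideanSpace ℝ (Fin 3))).restrict
              ((fun s => A (s - q)) '' Y) := by
  intro hX1 hFloor hMC δ hδ P hP hcore hstat hE
  -- the floor and the minimising hypothesis in `eStar` form (definitional)
  have hU : ∀ δ : ℝ, 0 < δ → ∀ P : Measure (Measure (EuclideanSpace ℝ (Fin 3))),
      IsProbabilityMeasure P → (∀ᵐ μ ∂P, IsRootedHardCore δ μ) → IsPointStationaryLaw P →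
      eStar ≤ ∫ μ, rootEnergy lennardJones μ ∂P := hFloor
  have hE' : ∫ μ, rootEnergy lennardJones μ ∂P ≤ eStar := hE
  -- §3 the countably many charged classes of `δ`-separated sets and their union `U`
  set 𝒦 : Set (Set (Measure (EuclideanSpace ℝ (Fin 3)))) :=
    {K | ∃ Y : Set (EuclideanSpace ℝ (Fin 3)), (∀ x ∈ Y, ∀ y ∈ Y, x ≠ y → δ ≤ dist x y) ∧
      K = {ν : Measure (EuclideanSpace ℝ (Fin 3)) |
        ∃ A : EuclideanSpace ℝ (Fin 3) →ₗᵢ[ℝ] EuclideanSpace ℝ (Fin 3), ∃ q ∈ Y,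
          ν = (Measure.count : Measure (EuclideanSpace ℝ (Fin 3))).restrict
            ((fun s => A (s - q)) '' Y)} ∧ P K ≠ 0}
  have h𝒦meas : ∀ K ∈ 𝒦, MeasurableSet K := by
    rintro K ⟨Y, hsep, rfl, -⟩
    exact measurableSet_cls hMC hδ hsep
  have h𝒦disj : ∀ K ∈ 𝒦, ∀ K' ∈ 𝒦, K ≠ K' → Disjoint K K' := by
    rintro K ⟨Y, -, rfl, -⟩ K' ⟨Y', -, rfl, -⟩ hne
    exact Set.disjoint_left.2 fun ν hν hν' => hne (cls_eq_of_mem_of_mem hν hν')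
  have h𝒦count : 𝒦.Countable := by
    have h := Measure.countable_meas_pos_of_disjoint_iUnion (μ := P)
      (As := fun K : 𝒦 => (K : Set (Measure (EuclideanSpace ℝ (Fin 3)))))
      (fun K => h𝒦meas K K.2)
      (fun K K' hne => h𝒦disj K K.2 K' K'.2 fun h => hne (Subtype.ext h))
    have huniv : {K : 𝒦 | 0 < P (K : Set (Measure (EuclideanSpace ℝ (Fin 3))))} = Set.univ := by
      ext K
      simp only [Set.mem_setOf_eq, Set.mem_univ, iff_true]
      obtain ⟨-, -, -, hpos⟩ := K.2
      exact pos_iff_ne_zero.2 hpos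
    rw [huniv] at h
    exact Set.countable_coe_iff.1 (Set.countable_univ_iff.1 h)
  set U : Set (Measure (EuclideanSpace ℝ (Fin 3))) := ⋃₀ 𝒦
  have hUmeas : MeasurableSet U := MeasurableSet.sUnion h𝒦count h𝒦meas
  -- §5 `U` is re-rooting invariant at the points of a.e. configuration
  have hinvU : ∀ᵐ μ ∂P, ∀ᵐ y ∂μ,
      (Measure.map (fun z => z - y) μ ∈ U ↔ μ ∈ U) := by
    filter_upwards [hcore] with μ hμ
    obtain ⟨S, h0, hsep, rfl⟩ := hμ
    have hSm : MeasurableSet S := (countable_of_separated hδ hsep).measurableSet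
    refine ae_restrict_of_forall_mem hSm fun y hy => ?_
    constructor
    · intro hθ
      obtain ⟨K, hK, hθK⟩ := Set.mem_sUnion.1 hθ
      obtain ⟨Y, hsepY, rfl, hpos⟩ := hK
      have hpt : (Measure.map (fun z => z - y)
          ((Measure.count : Measure (EuclideanSpace ℝ (Fin 3))).restrict S)) {-y} ≠ 0 := by
        rw [map_sub_count_restrict]
        exact (count_restrict_singleton_ne_zero_iff _ _).2 ⟨0, h0, zero_sub y⟩
      have hback := map_sub_mem_cls hθK hpt
      rw [Measure.map_map (measurable_sub_const _) (measurable_sub_const _),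
        show ((fun z : EuclideanSpace ℝ (Fin 3) => z - -y) ∘ fun z => z - y) = id from
          funext fun z => by simp, Measure.map_id] at hback
      exact Set.mem_sUnion.2 ⟨_, ⟨Y, hsepY, rfl, hpos⟩, hback⟩
    · intro hμU
      obtain ⟨K, hK, hμK⟩ := Set.mem_sUnion.1 hμU
      obtain ⟨Y, hsepY, rfl, hpos⟩ := hK
      exact Set.mem_sUnion.2 ⟨_, ⟨Y, hsepY, rfl, hpos⟩,
        map_sub_mem_cls hμK ((count_restrict_singleton_ne_zero_iff _ _).2 hy)⟩
  -- §4 / §6–7 exhaustion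
  by_cases hUc : P Uᶜ = 0
  · have hmem : ∀ᵐ μ ∂P, μ ∈ U :=
      (measure_eq_zero_iff_ae_notMem.1 hUc).mono fun μ hμ => Set.notMem_compl_iff.1 hμ
    filter_upwards [hmem] with μ hμ
    obtain ⟨K, hK, hμK⟩ := Set.mem_sUnion.1 hμ
    obtain ⟨Y, -, rfl, hpos⟩ := hK
    obtain ⟨A, q, hq, hμ⟩ := hμK
    exact ⟨Y, pos_iff_ne_zero.2 hpos, A, q, hq, hμ⟩
  · exfalso
    haveI : IsProbabilityMeasure ((P Uᶜ)⁻¹ • P.restrict Uᶜ) := isProbabilityMeasure_cond hUc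
    have hcore' : ∀ᵐ μ ∂((P Uᶜ)⁻¹ • P.restrict Uᶜ), IsRootedHardCore δ μ :=
      Measure.ae_smul_measure (ae_restrict_of_ae hcore) _
    have hstat' : IsPointStationaryLaw ((P Uᶜ)⁻¹ • P.restrict Uᶜ) :=
      (pureExhaustion_isPointStationaryLaw_restrict_of_ae P hstat Uᶜ hUmeas.compl
        (ae_invariant_compl hinvU)).smul _
    have hE'' : ∫ μ, rootEnergy lennardJones μ ∂((P Uᶜ)⁻¹ • P.restrict Uᶜ) ≤ eStar :=
      integral_rootEnergy_cond_le_of_ae hU hδ P hcore hstat hE' hUmeas.compl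
        (ae_invariant_compl hinvU) hUc
    obtain ⟨Y, hposY⟩ := hX1 δ hδ _ inferInstance hcore' hstat' hE''
    -- the class of `Y` is charged by `P` off `U` ...
    have hposP : P ({ν : Measure (EuclideanSpace ℝ (Fin 3)) |
        ∃ A : EuclideanSpace ℝ (Fin 3) →ₗᵢ[ℝ] EuclideanSpace ℝ (Fin 3), ∃ q ∈ Y,
          ν = (Measure.count : Measure (EuclideanSpace ℝ (Fin 3))).restrict
            ((fun s => A (s - q)) '' Y)} ∩ Uᶜ) ≠ 0 := by
      intro h0
      rw [Measure.smul_apply, Measure.restrict_apply' hUmeas.compl, h0, smul_zero] at hposY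
      exact lt_irrefl _ hposY
    -- ... hence charged by `P`, hence a member of `𝒦`, hence inside `U`: contradiction
    have hposK : P {ν : Measure (EuclideanSpace ℝ (Fin 3)) |
        ∃ A : EuclideanSpace ℝ (Fin 3) →ₗᵢ[ℝ] EuclideanSpace ℝ (Fin 3), ∃ q ∈ Y,
          ν = (Measure.count : Measure (EuclideanSpace ℝ (Fin 3))).restrict
            ((fun s => A (s - q)) '' Y)} ≠ 0 :=
      fun h0 => hposP (measure_mono_null Set.inter_subset_left h0)
    have hsepY := separated_of_measure_ne_zero hcore hposK
    have hsub := Set.subset_sUnion_of_mem (S := 𝒦) ⟨Y, hsepY, rfl, hposK⟩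
    exact hposP (measure_mono_null (fun ν hν => (hν.2 (hsub hν.1)).elim) measure_empty)

end Summit.AtomisticToContinuum.Crystallization.Theorems.IsometryAtomsMinimisingLawsCohesive

end
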